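import Summits.QuantumFields.BalabanUV.T4Continuum.Support.NE3QuadRemainderTower
import Literature.MathematicalPhysics.QuantumFieldTheory.Balaban1983to89.B7Prop5Flat
import HarnessLib

/-!
# T⁴ programme, node NE3, route Π item Π-C-3♭ — LOCALITY OF THE k-FOLD LINEARISED AVERAGE `dirIter` AND OF ITS NON-LINEAR TWIN
# `relIter`: BOTH DEPEND ON THE BACKGROUND `W` AND ON THE DIRECTION `X` ONLY THROUGH THE BONDS OF `B^k(c₋) ∪ B^k(c₊)`

NE3 formalisation swarm `b2b-balaban-t4-ne3-formalise-*`, LEAF PROVER 04 (gen 7); the owner's ADDED ASK Π-C-3♭ «LOCALITY» of ruling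
ρ-g25-1 (1) (HOME/CLAIMS.log l.22520): «state (or make derivable in ≤ 30 lines) that `relIter L k W X z κ` and `dirIter L k W X z κ` depend on
`X` only through its restriction to the block union feeding `(z,κ)` (so that the END with GLOBAL `s = sup‖X b‖` yields the LOCAL form … by
applying it to `X·1_{B̃}`)»; OFFER∕INTENT HOME/CLAIMS.log l.22596.

THE BOXES are the tree's, not new vocabulary: `B7Prop1Local.InBox lo hi`, `AgreeOn lo hi F F'` (equality on the bonds with BOTH endpoints in
`[lo, hi]`), the one-step box `[q, bondHi L q κ] = B(c₋) ∪ B(c₊)` of the `L`-bond `c = ⟨q, q + Le_κ⟩` and the level-`k` box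
`[loK L k z, bondHiK L k z κ] = B^k(c₋) ∪ B^k(c₊)` of [Balaban1985Averaging] p. 24 — exactly the regions of the tree's printed locality
`B7Prop1Local.bavg_congr` ∕ `avgIter_congr`; the restriction device `X·1_{B̃}` is the tree's `B7Prop3Flat.insCfg (bondsIn lo hi) (restr _ X)` of
`B7Prop5Flat` (value `X` on the bonds of the box, `0` elsewhere).  0 def.

CONTENT (all [folklore]; 0 sorry):
§1 boxes: `agreeOn_vary` (perturbations of agreeing data agree), the corner∕block-point memberships of the one-step box, the base level
   `eq_of_agreeOn_level_zero`, and THE NESTING `agreeOn_blockPair_of_succ`: the one-step box of a level-`k` bond `(y, μ)` of the level-`k` box of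
   `(z, κ)` lies in the level-`(k+1)` box of `(z, κ)` (the arithmetic of `B7Prop1Local.avgIter_congr`, inner-first);
§2 ONE STEP, jointly in `(W, X)`: `Wcx_vary_congr₂`, `mlogDeriv_congr₂`, `XavgDeriv_congr₂`, `Xavg_congr_of_agreeOn`, `dhol_seg_congr₂` (by
   uniqueness of the derivative of `s ↦ V_s(Γ_c)`, `AveragingDeficitTransport.hasDerivAt_val_hol_vary_word`), `sideDeriv_congr₂`,
   **`pushDir_congr₂`**, **`cpush_congr₂`** ∕ `cpush_congr`, `cavg_congr_of_agreeOn`, **`relStep_congr₂`** ∕ `relStep_congr`;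
§3 THE TOWER by induction on `k` (inner-first, `dirIter_succ` ∕ `relIter_succ` are `rfl`): `cavg_agreeOn_of_succ`, `cpush_agreeOn_of_succ`,
   `relStep_agreeOn_of_succ`, **`dirIter_congr₂`** ∕ **`dirIter_congr`**, **`relIter_congr₂`** ∕ **`relIter_congr`**, and the quadratic remainder
   `C_W^{(k)}(X) = relIter − dirIter`: **`relIter_sub_dirIter_congr`**;
§4 THE RESTRICTION `X·1_{B̃_k(z,κ)}` BY NAME: `insCfg_restr_apply`, `norm_insCfg_restr_le` (a sup bound ON THE BOX becomes a GLOBAL sup bound of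
   the restricted direction), `isSkewDir_insCfg_restr`, **`dirIter_eq_dirIter_restrict`**, **`relIter_eq_relIter_restrict`**,
   **`relIter_sub_dirIter_eq_restrict`** — so any END stated with a GLOBAL sup hypothesis on `X` (and none on its periodicity) applies verbatim
   to the restricted direction and yields the LOCAL form at `(z, κ)`.

HONEST FRAMING.  Kinematic bookkeeping of the averaging map (42) on OUR frame (tree objects `bavg`∕`cavg`∕`pushDir`∕`cpush`∕`dirIter`∕`relStep`∕
`relIter` BY NAME); NO estimate, nothing about Bałaban's minimisers; the k-free bound on `relIter − dirIter` is leaf-02-g7's Π-C-3; `DecomposedRep`'s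
sizes, T-E_w♯, NE3 NOT proved; spine PROVED 0∕9; finite T⁴ rung (B)+1 — NOT infinite volume, NOT mass gap, NOT BetaPertH, NOT Clay.  Periodicity of
`X` is neither used nor produced (the restriction breaks it).  ABSOLUTE RULE kept (no printed sentence is a hypothesis; context only:
[Balaban1985Averaging] (42)–(43) pp. 23–24 and the locality sentence after (43), p. 24).  PLACEMENT: `Summits/QuantumFields/BalabanUV/`.
HONEST DEPENDENCY: continuum YM on T⁴ ⇐ BetaPertH ∧ nine spine estimates (0/9 proved); BetaPertH ⇐ (D1) ∧ (D4) ∧ CAP+tail; G-an2-4 gates asym,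
D1 and NE2/3/4.
-/

set_option autoImplicit false

open scoped BigOperators Matrix.Norms.L2Operator
open NormedSpace Finset

namespace Summit.QuantumFields.BalabanUV.T4Continuum.NE3LinearisedAverageLocality

open Literature.MathematicalPhysics.QuantumFieldTheory.Balaban1983to89
open B7Prop1Explicit B7Prop2Explicit MatrixLog
open B7Prop1Local (InBox AgreeOn bondHi loK bondHiK bavg_congr Wcx_congr hol_seg_congr add_zsmul_e_apply add_e_apply)
open B7Prop3Flat (insCfg)
open B7Prop5Flat (BondIn bondsIn mem_bondsIn restr agreeOn_insCfg_restr insCfg_restr_of_mem)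
open T4AveragingDeficitWall (IsSkewDir vary vary_zero Ad)
open AveragingDeficitChartCalculus (cavg)
open AveragingDeficitMultiLevelPrep (cpush cavgIter)
open AveragingDeficitResidualPairing (pushDir)
open AveragingDeficitSideDeriv (mlogDeriv XavgDeriv sideDeriv)
open AveragingDeficitTransport (dhol hasDerivAt_val_hol_vary_word)
open NE3TangentCovariantTower (dirIter dirIter_succ dirIter_zero)
open NE3QuadRemainderTower (relStep relIter relIter_succ relIter_zero relStep_eq cpush_eq)

noncomputable section

variable {d : ℕ} {n : Type*} [Fintype n] [DecidableEq n]

/-! ## §1 Boxes: perturbations, the one-step box, the base level, the nesting of the level boxes -/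

section Boxes

variable {G : Type*}

omit [Fintype n] [DecidableEq n] in
/-- Agreement on a box is reflexive. [folklore] -/
theorem agreeOn_self (lo hi : Site d) (F : Site d → Fin d → G) : AgreeOn lo hi F F := fun _ _ _ _ => rfl

omit [Fintype n] [DecidableEq n] in
/-- THE BASE LEVEL: the level-`0` box of the unit bond `(z, κ)` contains both its endpoints, so agreeing fields have the same value there.
[cite: Balaban1985Averaging, p.24] -/
theorem eq_of_agreeOn_level_zero (L : ℕ) {F F' : Site d → Fin d → G} (z : Site d) (κ : Fin d)
    (h : AgreeOn (loK L 0 z) (bondHiK L 0 z κ) F F') : F z κ = F' z κ := by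
  refine h z κ (fun i => ?_) (fun i => ?_)
  · simp only [loK, bondHiK, pow_zero, one_mul]; split_ifs <;> omega
  · simp only [loK, bondHiK, pow_zero, one_mul, add_e_apply]; split_ifs <;> omega

omit [Fintype n] [DecidableEq n] in
/-- **THE NESTING OF THE LEVEL BOXES** (inner-first): if `(y, μ)` is a bond of the level-`k` box `B^k(c₋) ∪ B^k(c₊)` of `c = (z, κ)` (both
endpoints in `[loK L k z, bondHiK L k z κ]`), then the one-step box `B(Ly) ∪ B(L(y + e_μ)) = [L•y, bondHi L (L•y) μ]` of the `L`-bond over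
`(y, μ)` lies in the level-`(k+1)` box `[loK L (k+1) z, bondHiK L (k+1) z κ]`; hence fields agreeing on the latter agree on the former.
[cite: Balaban1985Averaging, p.24] -/
theorem agreeOn_blockPair_of_succ {L : ℕ} (hL : 1 ≤ L) (k : ℕ) (z : Site d) (κ : Fin d) {F F' : Site d → Fin d → G}
    (h : AgreeOn (loK L (k + 1) z) (bondHiK L (k + 1) z κ) F F') {y : Site d} {μ : Fin d}
    (hy : InBox (loK L k z) (bondHiK L k z κ) y) (hye : InBox (loK L k z) (bondHiK L k z κ) (y + e μ)) :
    AgreeOn ((L : ℤ) • y) (bondHi L ((L : ℤ) • y) μ) F F' := by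
  have hL0 : (0 : ℤ) ≤ (L : ℤ) := by positivity
  have hP : (0 : ℤ) ≤ (L : ℤ) ^ k := by positivity
  refine h.mono (fun i => ?_) (fun i => ?_)
  · have h1 := (hy i).1
    simp only [loK] at h1
    have h1' := mul_le_mul_of_nonneg_left h1 hL0
    simp only [loK, Pi.smul_apply, smul_eq_mul, pow_succ]
    nlinarith
  · have h2 := (hye i).2
    simp only [bondHiK, add_e_apply] at h2
    have h2' := mul_le_mul_of_nonneg_left h2 hL0
    simp only [bondHi, bondHiK, Pi.smul_apply, smul_eq_mul, pow_succ]
    split_ifs at h2' ⊢ with hμ hκ hκ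
    · nlinarith
    · nlinarith
    · nlinarith
    · nlinarith

end Boxes

/-- Perturbations `V e^{sψ}`, `V′ e^{sψ′}` of data agreeing on a box agree on the box. [folklore] -/
theorem agreeOn_vary {lo hi : Site d} {V V' : Site d → Fin d → (Matrix n n ℂ)ˣ} {ψ ψ' : Site d → Fin d → Matrix n n ℂ} (hV : AgreeOn lo hi V V')
    (hψ : AgreeOn lo hi ψ ψ') (s : ℝ) : AgreeOn lo hi (vary V ψ s) (vary V' ψ' s) := fun x κ hx hx' => by
  simp only [vary, hV x κ hx hx', hψ x κ hx hx']

omit [Fintype n] [DecidableEq n] in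
/-- The lower corner `c₋ = q` lies in the one-step box `[q, bondHi L q κ]` (`L ≥ 1`). [folklore] -/
theorem inBox_corner {L : ℕ} (hL : 1 ≤ L) (q : Site d) (κ : Fin d) : InBox q (bondHi L q κ) q := fun i => by
  simp only [bondHi]; split_ifs <;> omega

omit [Fintype n] [DecidableEq n] in
/-- The upper corner `c₊ = q + Le_κ` lies in the one-step box. [folklore] -/
theorem inBox_far_corner {L : ℕ} (hL : 1 ≤ L) (q : Site d) (κ : Fin d) : InBox q (bondHi L q κ) (q + (L : ℤ) • e κ) := fun i => by
  simp only [bondHi, add_zsmul_e_apply]; split_ifs <;> omega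

omit [Fintype n] [DecidableEq n] in
/-- A block point `x = q + r`, `r ∈ [0, L)^d`, lies in the one-step box. [folklore] -/
theorem inBox_blockPoint (L : ℕ) (q : Site d) (κ : Fin d) (r : Fin d → Fin L) : InBox q (bondHi L q κ) (q + boxVec L r) := fun i => by
  have h0 : (0 : ℤ) ≤ boxVec L r i := by simp [boxVec]
  have h1 : boxVec L r i + 1 ≤ L := by have := (r i).isLt; simp only [boxVec]; omega
  simp only [bondHi, Pi.add_apply]; split_ifs <;> omega

omit [Fintype n] [DecidableEq n] in
/-- Its translate `x(c) = q + r + Le_κ` lies in the one-step box. [folklore] -/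
theorem inBox_blockPoint_far (L : ℕ) (q : Site d) (κ : Fin d) (r : Fin d → Fin L) :
    InBox q (bondHi L q κ) (q + boxVec L r + (L : ℤ) • e κ) := fun i => by
  have h0 : (0 : ℤ) ≤ boxVec L r i := by simp [boxVec]
  have h1 : boxVec L r i + 1 ≤ L := by have := (r i).isLt; simp only [boxVec]; omega
  simp only [bondHi, Pi.add_apply, Pi.smul_apply, smul_eq_mul, e_apply, mul_ite, mul_one, mul_zero]
  split_ifs <;> omega

/-! ## §2 One step, jointly in the background and the direction -/

section OneStep

/-- The loop variables `W_s = V_s(Γ_{c,x})V_s(c)⁻¹` of (42) along the perturbations agree for all `s`. [cite: Balaban1985Averaging, (42) p.23] -/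
theorem Wcx_vary_congr₂ {L : ℕ} (hL : 1 ≤ L) {V V' : Site d → Fin d → (Matrix n n ℂ)ˣ} {ψ ψ' : Site d → Fin d → Matrix n n ℂ} {q : Site d} {κ : Fin d} (hV : AgreeOn q (bondHi L q κ) V V')
    (hψ : AgreeOn q (bondHi L q κ) ψ ψ') (r : Fin d → Fin L) (s : ℝ) :
    Wcx L (vary V ψ s) q κ (boxVec L r) = Wcx L (vary V' ψ' s) q κ (boxVec L r) :=
  Wcx_congr L (agreeOn_vary hV hψ s) q κ _ (inBox_corner hL q κ) (inBox_blockPoint L q κ r) (inBox_blockPoint_far L q κ r)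
    (inBox_far_corner hL q κ)

/-- Hence `(log W_s)′(0)` agrees. [folklore] -/
theorem mlogDeriv_congr₂ {L : ℕ} (hL : 1 ≤ L) {V V' : Site d → Fin d → (Matrix n n ℂ)ˣ} {ψ ψ' : Site d → Fin d → Matrix n n ℂ} {q : Site d} {κ : Fin d} (hV : AgreeOn q (bondHi L q κ) V V')
    (hψ : AgreeOn q (bondHi L q κ) ψ ψ') (r : Fin d → Fin L) :
    mlogDeriv L V ψ q κ (boxVec L r) = mlogDeriv L V' ψ' q κ (boxVec L r) := by
  unfold mlogDeriv
  congr 1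
  funext s
  rw [Wcx_vary_congr₂ hL hV hψ r s]

/-- Hence `X_c′` agrees. [folklore] -/
theorem XavgDeriv_congr₂ {L : ℕ} (hL : 1 ≤ L) {V V' : Site d → Fin d → (Matrix n n ℂ)ˣ} {ψ ψ' : Site d → Fin d → Matrix n n ℂ} {q : Site d} {κ : Fin d} (hV : AgreeOn q (bondHi L q κ) V V')
    (hψ : AgreeOn q (bondHi L q κ) ψ ψ') : XavgDeriv L V ψ q κ = XavgDeriv L V' ψ' q κ := by
  unfold XavgDeriv
  exact Finset.sum_congr rfl fun r _ => by rw [mlogDeriv_congr₂ hL hV hψ r]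

/-- The exponent `X_c` of (42) depends only on the bonds of `B(c₋) ∪ B(c₊)`. [cite: Balaban1985Averaging, (42) p.23, p.24] -/
theorem Xavg_congr_of_agreeOn {L : ℕ} (hL : 1 ≤ L) {V V' : Site d → Fin d → (Matrix n n ℂ)ˣ} {q : Site d} {κ : Fin d} (hV : AgreeOn q (bondHi L q κ) V V') :
    Xavg L V q κ = Xavg L V' q κ := by
  have hW : ∀ r : Fin d → Fin L, Wcx L V q κ (boxVec L r) = Wcx L V' q κ (boxVec L r) := fun r =>
    Wcx_congr L hV q κ _ (inBox_corner hL q κ) (inBox_blockPoint L q κ r) (inBox_blockPoint_far L q κ r) (inBox_far_corner hL q κ)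
  simp only [Xavg, hW]

/-- The linearised transport `(δ_ψV)(Γ_c)` along the central contour agrees — by uniqueness of the derivative of `s ↦ V_s(Γ_c)`, which
agrees for all `s`. [cite: Balaban1985Averaging, (9) p.18, (42) p.23] -/
theorem dhol_seg_congr₂ {L : ℕ} (hL : 1 ≤ L) {V V' : Site d → Fin d → (Matrix n n ℂ)ˣ} {ψ ψ' : Site d → Fin d → Matrix n n ℂ} {q : Site d} {κ : Fin d} (hV : AgreeOn q (bondHi L q κ) V V')
    (hψ : AgreeOn q (bondHi L q κ) ψ ψ') : dhol V ψ q (seg κ (L : ℤ)) = dhol V' ψ' q (seg κ (L : ℤ)) := by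
  have h1 := hasDerivAt_val_hol_vary_word V ψ (seg κ (L : ℤ)) q
  have h2 := hasDerivAt_val_hol_vary_word V' ψ' (seg κ (L : ℤ)) q
  have e1 : (fun s : ℝ => ((hol (vary V ψ s) q (seg κ (L : ℤ)) : (Matrix n n ℂ)ˣ) : Matrix n n ℂ))
      = fun s : ℝ => ((hol (vary V' ψ' s) q (seg κ (L : ℤ)) : (Matrix n n ℂ)ˣ) : Matrix n n ℂ) :=
    funext fun s => by rw [hol_seg_congr (agreeOn_vary hV hψ s) κ L q (inBox_corner hL q κ) (inBox_far_corner hL q κ)]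
  rw [e1] at h1
  have h := h1.unique h2
  rw [hol_seg_congr hV κ L q (inBox_corner hL q κ) (inBox_far_corner hL q κ)] at h
  exact (Units.mul_left_inj _).mp h

/-- The left-trivialised derivative `δV̄(c)` of the averaged bond agrees. [cite: Balaban1985Averaging, (42) p.23] -/
theorem sideDeriv_congr₂ {L : ℕ} (hL : 1 ≤ L) {V V' : Site d → Fin d → (Matrix n n ℂ)ˣ} {ψ ψ' : Site d → Fin d → Matrix n n ℂ} {q : Site d} {κ : Fin d} (hV : AgreeOn q (bondHi L q κ) V V')
    (hψ : AgreeOn q (bondHi L q κ) ψ ψ') : sideDeriv L V ψ q κ = sideDeriv L V' ψ' q κ := by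
  unfold sideDeriv
  rw [Xavg_congr_of_agreeOn hL hV, XavgDeriv_congr₂ hL hV hψ, dhol_seg_congr₂ hL hV hψ]

/-- **LOCALITY OF THE PUSH-FORWARD (42), jointly in background and direction**: backgrounds and directions agreeing on the bonds of
`B(c₋) ∪ B(c₊)` have the same `Φ(c) = dV̄_V[ψ](c)`. [cite: Balaban1985Averaging, (42) p.23, p.24] -/
theorem pushDir_congr₂ {L : ℕ} (hL : 1 ≤ L) {V V' : Site d → Fin d → (Matrix n n ℂ)ˣ} {ψ ψ' : Site d → Fin d → Matrix n n ℂ} {q : Site d} {κ : Fin d} (hV : AgreeOn q (bondHi L q κ) V V')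
    (hψ : AgreeOn q (bondHi L q κ) ψ ψ') : pushDir L V ψ q κ = pushDir L V' ψ' q κ := by
  unfold pushDir
  rw [bavg_congr L hL q κ hV, sideDeriv_congr₂ hL hV hψ]

end OneStep

/-- **LOCALITY OF THE ONE-STEP LINEARISED AVERAGE ON THE UNIT LATTICE**: `cpush L W X z κ` depends on `(W, X)` only through the bonds of
`[L•z, bondHi L (L•z) κ] = B(Lz) ∪ B(L(z + e_κ))`. [cite: Balaban1985Averaging, (42) p.23, p.24] -/
theorem cpush_congr₂ {L : ℕ} (hL : 1 ≤ L) {W W' : Site d → Fin d → (Matrix n n ℂ)ˣ} {X X' : Site d → Fin d → Matrix n n ℂ} (z : Site d) (κ : Fin d)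
    (hW : AgreeOn ((L : ℤ) • z) (bondHi L ((L : ℤ) • z) κ) W W') (hX : AgreeOn ((L : ℤ) • z) (bondHi L ((L : ℤ) • z) κ) X X') :
    cpush L W X z κ = cpush L W' X' z κ := by
  rw [cpush_eq, cpush_eq, pushDir_congr₂ hL hW hX]

/-- The direction-only form: `cpush L W X z κ = cpush L W X′ z κ` for directions agreeing on `B(Lz) ∪ B(L(z + e_κ))`. [folklore] -/
theorem cpush_congr {L : ℕ} (hL : 1 ≤ L) (W : Site d → Fin d → (Matrix n n ℂ)ˣ) {X X' : Site d → Fin d → Matrix n n ℂ} (z : Site d) (κ : Fin d)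
    (hX : AgreeOn ((L : ℤ) • z) (bondHi L ((L : ℤ) • z) κ) X X') : cpush L W X z κ = cpush L W X' z κ :=
  cpush_congr₂ hL z κ (agreeOn_self _ _ W) hX

/-- The averaged configuration on the unit lattice is local: `cavg L W y μ` depends only on the bonds of `B(Ly) ∪ B(L(y + e_μ))`
(`B7Prop1Local.bavg_congr` read at `q = L•y`). [cite: Balaban1985Averaging, p.24 (sentence after (43))] -/
theorem cavg_congr_of_agreeOn {L : ℕ} (hL : 1 ≤ L) {W W' : Site d → Fin d → (Matrix n n ℂ)ˣ} (y : Site d) (μ : Fin d)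
    (hW : AgreeOn ((L : ℤ) • y) (bondHi L ((L : ℤ) • y) μ) W W') : cavg L W y μ = cavg L W' y μ :=
  bavg_congr L hL _ μ hW

/-- **LOCALITY OF THE ONE-STEP RELATIVE LOG-COORDINATE**: `relStep L W X y κ` depends on `(W, X)` only through the bonds of
`B(Ly) ∪ B(L(y + e_κ))` (two instances of `bavg_congr`, the second for `W e^{X}`). [cite: Balaban1985Averaging, p.24 (sentence after (43))] -/
theorem relStep_congr₂ {L : ℕ} (hL : 1 ≤ L) {W W' : Site d → Fin d → (Matrix n n ℂ)ˣ} {X X' : Site d → Fin d → Matrix n n ℂ} (y : Site d) (κ : Fin d)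
    (hW : AgreeOn ((L : ℤ) • y) (bondHi L ((L : ℤ) • y) κ) W W') (hX : AgreeOn ((L : ℤ) • y) (bondHi L ((L : ℤ) • y) κ) X X') :
    relStep L W X y κ = relStep L W' X' y κ := by
  rw [relStep_eq, relStep_eq, bavg_congr L hL _ κ hW, bavg_congr L hL _ κ (agreeOn_vary hW hX 1)]

/-- The direction-only form of `relStep_congr₂`. [folklore] -/
theorem relStep_congr {L : ℕ} (hL : 1 ≤ L) (W : Site d → Fin d → (Matrix n n ℂ)ˣ) {X X' : Site d → Fin d → Matrix n n ℂ} (y : Site d) (κ : Fin d)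
    (hX : AgreeOn ((L : ℤ) • y) (bondHi L ((L : ℤ) • y) κ) X X') : relStep L W X y κ = relStep L W X' y κ :=
  relStep_congr₂ hL y κ (agreeOn_self _ _ W) hX

/-! ## §3 The tower -/

/-- One averaging step maps agreement on the level-`(k+1)` box to agreement of the averaged backgrounds on the level-`k` box. [folklore] -/
theorem cavg_agreeOn_of_succ {L : ℕ} (hL : 1 ≤ L) (k : ℕ) (z : Site d) (κ : Fin d) {W W' : Site d → Fin d → (Matrix n n ℂ)ˣ}
    (hW : AgreeOn (loK L (k + 1) z) (bondHiK L (k + 1) z κ) W W') :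
    AgreeOn (loK L k z) (bondHiK L k z κ) (cavg L W) (cavg L W') := fun _ μ hy hye =>
  cavg_congr_of_agreeOn hL _ μ (agreeOn_blockPair_of_succ hL k z κ hW hy hye)

/-- One linearised step maps agreement on the level-`(k+1)` box to agreement of the pushed directions on the level-`k` box. [folklore] -/
theorem cpush_agreeOn_of_succ {L : ℕ} (hL : 1 ≤ L) (k : ℕ) (z : Site d) (κ : Fin d) {W W' : Site d → Fin d → (Matrix n n ℂ)ˣ}
    {X X' : Site d → Fin d → Matrix n n ℂ} (hW : AgreeOn (loK L (k + 1) z) (bondHiK L (k + 1) z κ) W W')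
    (hX : AgreeOn (loK L (k + 1) z) (bondHiK L (k + 1) z κ) X X') :
    AgreeOn (loK L k z) (bondHiK L k z κ) (cpush L W X) (cpush L W' X') := fun _ μ hy hye =>
  cpush_congr₂ hL _ μ (agreeOn_blockPair_of_succ hL k z κ hW hy hye) (agreeOn_blockPair_of_succ hL k z κ hX hy hye)

/-- One relative step maps agreement on the level-`(k+1)` box to agreement of the relative coordinates on the level-`k` box. [folklore] -/
theorem relStep_agreeOn_of_succ {L : ℕ} (hL : 1 ≤ L) (k : ℕ) (z : Site d) (κ : Fin d) {W W' : Site d → Fin d → (Matrix n n ℂ)ˣ}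
    {X X' : Site d → Fin d → Matrix n n ℂ} (hW : AgreeOn (loK L (k + 1) z) (bondHiK L (k + 1) z κ) W W')
    (hX : AgreeOn (loK L (k + 1) z) (bondHiK L (k + 1) z κ) X X') :
    AgreeOn (loK L k z) (bondHiK L k z κ) (relStep L W X) (relStep L W' X') := fun _ μ hy hye =>
  relStep_congr₂ hL _ μ (agreeOn_blockPair_of_succ hL k z κ hW hy hye) (agreeOn_blockPair_of_succ hL k z κ hX hy hye)

/-- **LOCALITY OF THE k-FOLD LINEARISED AVERAGE, jointly**: `dirIter L k W X z κ` depends on the background `W` and on the direction `X`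
only through their values on the bonds of `B^k(c₋) ∪ B^k(c₊) = [loK L k z, bondHiK L k z κ]`, `c = (z, κ)` — the linearisation of the printed
locality of the `k`-fold average (43) («depends only on the bond variables `U_b` for `b ⊂ B^k(c₋) ∪ B^k(c₊)`», kernel form
`B7Prop1Local.avgIter_congr`), by the same induction on `k`. [cite: Balaban1985Averaging, p.24 (sentence after (43))] -/
theorem dirIter_congr₂ {L : ℕ} (hL : 1 ≤ L) :
    ∀ (k : ℕ) {W W' : Site d → Fin d → (Matrix n n ℂ)ˣ} {X X' : Site d → Fin d → Matrix n n ℂ} (z : Site d) (κ : Fin d),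
      AgreeOn (loK L k z) (bondHiK L k z κ) W W' → AgreeOn (loK L k z) (bondHiK L k z κ) X X' →
        dirIter L k W X z κ = dirIter L k W' X' z κ
  | 0, _, _, _, _, z, κ, _, hX => by
    rw [dirIter_zero, dirIter_zero]
    exact eq_of_agreeOn_level_zero L z κ hX
  | k + 1, _, _, _, _, z, κ, hW, hX => by
    rw [dirIter_succ, dirIter_succ]
    exact dirIter_congr₂ hL k z κ (cavg_agreeOn_of_succ hL k z κ hW) (cpush_agreeOn_of_succ hL k z κ hW hX)

/-- **Π-C-3♭ FOR `dirIter`** (direction only, background fixed): `dirIter L k W X z κ = dirIter L k W X′ z κ` whenever `X` and `X′` agree on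
the bonds of `B^k(c₋) ∪ B^k(c₊)`. [cite: Balaban1985Averaging, p.24 (sentence after (43))] -/
theorem dirIter_congr {L : ℕ} (hL : 1 ≤ L) (k : ℕ) (W : Site d → Fin d → (Matrix n n ℂ)ˣ) {X X' : Site d → Fin d → Matrix n n ℂ} (z : Site d) (κ : Fin d)
    (hX : AgreeOn (loK L k z) (bondHiK L k z κ) X X') : dirIter L k W X z κ = dirIter L k W X' z κ :=
  dirIter_congr₂ hL k z κ (agreeOn_self _ _ W) hX

/-- **LOCALITY OF THE k-FOLD RELATIVE LOG-COORDINATE, jointly**: `relIter L k W X z κ` depends on `(W, X)` only through the bonds of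
`B^k(c₋) ∪ B^k(c₊)`. [cite: Balaban1985Averaging, p.24 (sentence after (43))] -/
theorem relIter_congr₂ {L : ℕ} (hL : 1 ≤ L) :
    ∀ (k : ℕ) {W W' : Site d → Fin d → (Matrix n n ℂ)ˣ} {X X' : Site d → Fin d → Matrix n n ℂ} (z : Site d) (κ : Fin d),
      AgreeOn (loK L k z) (bondHiK L k z κ) W W' → AgreeOn (loK L k z) (bondHiK L k z κ) X X' →
        relIter L k W X z κ = relIter L k W' X' z κ
  | 0, _, _, _, _, z, κ, _, hX => by
    rw [relIter_zero, relIter_zero]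
    exact eq_of_agreeOn_level_zero L z κ hX
  | k + 1, _, _, _, _, z, κ, hW, hX => by
    rw [relIter_succ, relIter_succ]
    exact relIter_congr₂ hL k z κ (cavg_agreeOn_of_succ hL k z κ hW) (relStep_agreeOn_of_succ hL k z κ hW hX)

/-- **Π-C-3♭ FOR `relIter`** (direction only, background fixed). [cite: Balaban1985Averaging, p.24 (sentence after (43))] -/
theorem relIter_congr {L : ℕ} (hL : 1 ≤ L) (k : ℕ) (W : Site d → Fin d → (Matrix n n ℂ)ˣ) {X X' : Site d → Fin d → Matrix n n ℂ} (z : Site d) (κ : Fin d)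
    (hX : AgreeOn (loK L k z) (bondHiK L k z κ) X X') : relIter L k W X z κ = relIter L k W X' z κ :=
  relIter_congr₂ hL k z κ (agreeOn_self _ _ W) hX

/-- **Π-C-3♭ FOR THE QUADRATIC REMAINDER `C_W^{(k)}(X) = relIter − dirIter`**: it depends on `X` only through the bonds of `B^k(c₋) ∪ B^k(c₊)`.
[cite: Balaban1985Averaging, (134)–(135) p.38, p.24] -/
theorem relIter_sub_dirIter_congr {L : ℕ} (hL : 1 ≤ L) (k : ℕ) (W : Site d → Fin d → (Matrix n n ℂ)ˣ) {X X' : Site d → Fin d → Matrix n n ℂ} (z : Site d)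
    (κ : Fin d) (hX : AgreeOn (loK L k z) (bondHiK L k z κ) X X') :
    relIter L k W X z κ - dirIter L k W X z κ = relIter L k W X' z κ - dirIter L k W X' z κ := by
  rw [relIter_congr hL k W z κ hX, dirIter_congr hL k W z κ hX]

/-! ## §4 The restriction `X·1_{B̃}` by name: the tree's `insCfg (bondsIn lo hi) (restr _ X)` -/

section Restrict

variable {lo hi : Site d}

/-- The restricted direction: `X` on the bonds with both endpoints in `[lo, hi]`, `0` on every other bond. [folklore] -/
theorem insCfg_restr_apply (X : Site d → Fin d → Matrix n n ℂ) (x : Site d) (μ : Fin d) [Decidable (BondIn lo hi x μ)] :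
    insCfg (bondsIn lo hi) (restr (bondsIn lo hi) X) x μ = if BondIn lo hi x μ then X x μ else 0 := by
  by_cases h : BondIn lo hi x μ
  · rw [if_pos h, insCfg_restr_of_mem _ _ (mem_bondsIn.mpr h)]
  · rw [if_neg h]
    have h' : (x, μ) ∉ bondsIn lo hi := fun hm => h (mem_bondsIn.mp hm)
    simp only [insCfg, h', dite_false]

/-- Off the box the restricted direction vanishes. [folklore] -/
theorem insCfg_restr_of_not (X : Site d → Fin d → Matrix n n ℂ) {x : Site d} {μ : Fin d} (h : ¬ BondIn lo hi x μ) :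
    insCfg (bondsIn lo hi) (restr (bondsIn lo hi) X) x μ = 0 := by
  classical
  rw [insCfg_restr_apply, if_neg h]

/-- **A SUP BOUND ON THE BOX IS A GLOBAL SUP BOUND OF THE RESTRICTION**: if `‖X b‖ ≤ s` for the bonds `b ⊂ [lo, hi]` (and `0 ≤ s`), then
`‖(X·1_{[lo,hi]}) b‖ ≤ s` for EVERY bond `b`. [folklore] -/
theorem norm_insCfg_restr_le (X : Site d → Fin d → Matrix n n ℂ) {s : ℝ} (hs : 0 ≤ s)
    (hX : ∀ (x : Site d) (μ : Fin d), InBox lo hi x → InBox lo hi (x + e μ) → ‖X x μ‖ ≤ s) (x : Site d) (μ : Fin d) :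
    ‖insCfg (bondsIn lo hi) (restr (bondsIn lo hi) X) x μ‖ ≤ s := by
  classical
  rw [insCfg_restr_apply]
  split_ifs with h
  · exact hX x μ h.1 h.2
  · rwa [norm_zero]

/-- The restriction of a direction that is skew on the box is skew everywhere. [folklore] -/
theorem isSkewDir_insCfg_restr (X : Site d → Fin d → Matrix n n ℂ)
    (hX : ∀ (x : Site d) (μ : Fin d), InBox lo hi x → InBox lo hi (x + e μ) → X x μ ∈ skewAdjoint (Matrix n n ℂ)) :
    IsSkewDir (insCfg (bondsIn lo hi) (restr (bondsIn lo hi) X)) := fun x μ => by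
  classical
  rw [insCfg_restr_apply]
  split_ifs with h
  · exact hX x μ h.1 h.2
  · exact (skewAdjoint (Matrix n n ℂ)).zero_mem

end Restrict

/-- **THE DEVICE OF ρ-g25-1 (1) FOR `dirIter`**: the k-fold linearised average at `(z, κ)` of `X` equals that of `X` restricted to the bonds of
`B^k(c₋) ∪ B^k(c₊)` (zero elsewhere) — so an END carrying a GLOBAL sup hypothesis on the direction applies to the restriction and reads the
sup OVER THE BOX only (`norm_insCfg_restr_le`). [cite: Balaban1985Averaging, p.24 (sentence after (43))] -/
theorem dirIter_eq_dirIter_restrict {L : ℕ} (hL : 1 ≤ L) (k : ℕ) (W : Site d → Fin d → (Matrix n n ℂ)ˣ) (X : Site d → Fin d → Matrix n n ℂ) (z : Site d)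
    (κ : Fin d) :
    dirIter L k W X z κ
      = dirIter L k W (insCfg (bondsIn (loK L k z) (bondHiK L k z κ)) (restr (bondsIn (loK L k z) (bondHiK L k z κ)) X)) z κ :=
  dirIter_congr hL k W z κ (agreeOn_insCfg_restr _ _ X)

/-- **THE DEVICE FOR `relIter`**: `relIter L k W X z κ = relIter L k W (X·1_{B^k(c₋) ∪ B^k(c₊)}) z κ`. [cite: Balaban1985Averaging, p.24 (sentence after (43))] -/
theorem relIter_eq_relIter_restrict {L : ℕ} (hL : 1 ≤ L) (k : ℕ) (W : Site d → Fin d → (Matrix n n ℂ)ˣ) (X : Site d → Fin d → Matrix n n ℂ) (z : Site d)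
    (κ : Fin d) :
    relIter L k W X z κ
      = relIter L k W (insCfg (bondsIn (loK L k z) (bondHiK L k z κ)) (restr (bondsIn (loK L k z) (bondHiK L k z κ)) X)) z κ :=
  relIter_congr hL k W z κ (agreeOn_insCfg_restr _ _ X)

/-- **THE DEVICE FOR THE QUADRATIC REMAINDER**: `(relIter − dirIter) L k W X z κ` equals the same for the restricted direction — the LOCAL form
`‖C_W(X)(z,κ)‖ ≤ C₂·(sup over B^k(c₋) ∪ B^k(c₊) of ‖X‖)²`-TYPE follows from any GLOBAL-sup END applied to `X·1_{B̃}`.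
[cite: Balaban1985Averaging, (134)–(135) p.38, p.24] -/
theorem relIter_sub_dirIter_eq_restrict {L : ℕ} (hL : 1 ≤ L) (k : ℕ) (W : Site d → Fin d → (Matrix n n ℂ)ˣ) (X : Site d → Fin d → Matrix n n ℂ)
    (z : Site d) (κ : Fin d) :
    relIter L k W X z κ - dirIter L k W X z κ
      = relIter L k W (insCfg (bondsIn (loK L k z) (bondHiK L k z κ)) (restr (bondsIn (loK L k z) (bondHiK L k z κ)) X)) z κ
        - dirIter L k W (insCfg (bondsIn (loK L k z) (bondHiK L k z κ)) (restr (bondsIn (loK L k z) (bondHiK L k z κ)) X)) z κ :=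
  relIter_sub_dirIter_congr hL k W z κ (agreeOn_insCfg_restr _ _ X)

end

end Summit.QuantumFields.BalabanUV.T4Continuum.NE3LinearisedAverageLocality
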